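import Mathlib
import Summits.AtomisticToContinuum.FouriersLaw.Theorems.ParityLiouvilleSeedCesaroUpgradeEntropy
import HarnessLib

/-!
# Cesàro upgrade, helper 4b: Donsker–Varadhan hard half and entropy bounds for weak limits

Support file for item `stmt-AtomisticToContinuum-13981` (`ParityLiouvilleSeed.CesaroUpgrade`);
sequel of `ParityLiouvilleSeedCesaroUpgradeEntropy`.

* `klDiv_le_of_forall_bounded_measurable` / `klDiv_le_of_forall_boundedContinuous` — the HARD
  HALF of the Donsker–Varadhan variational formula: if `∫ φ dμ - log ∫ e^φ dρ ≤ r` for every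
  bounded measurable (resp. bounded continuous, on a pseudo-metrizable Borel space) `φ`, then
  `H(μ | ρ) ≤ r` (`φ = t 𝟙_A` gives `μ ≪ ρ`; `φ_n = clamp_n (log dμ/dρ)` and Fatou give
  `∫ (dμ/dρ) log (dμ/dρ) dρ ≤ r`);
* `klDiv_le_of_tendsto`, `klDiv_le_of_tendsto_of_klDiv_le` — sublevel sets `{H(· | ρ) ≤ r}`
  are closed under weak limits along any filter (LOWER SEMICONTINUITY of the relative entropy in
  the form needed for the regularity of Cesàro limits).

No definitions.
-/

noncomputable section

namespace Summit.AtomisticToContinuum.FouriersLaw.Theorems.CesaroUpgrade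

open MeasureTheory Filter Topology Set BoundedContinuousFunction InformationTheory
open scoped ENNReal

variable {X : Type*} [MeasurableSpace X]

/-! ### The hard half: absolute continuity and the density argument -/

/-- **Donsker–Varadhan, hard half, measurable form**: if `∫ ψ dμ - log ∫ e^ψ dρ ≤ r` for every
bounded measurable `ψ`, then `H(μ | ρ) ≤ r` (first `μ ≪ ρ` with `ψ = t 𝟙_A`; then
`ψ_n = clamp_n log (dμ/dρ)` and Fatou). [folklore] -/
theorem klDiv_le_of_forall_bounded_measurable {μ ρ : Measure X} [IsProbabilityMeasure μ]
    [IsProbabilityMeasure ρ] {r : ℝ}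
    (h : ∀ ψ : X → ℝ, Measurable ψ → ∀ M : ℝ, (∀ x, |ψ x| ≤ M) →
      ∫ x, ψ x ∂μ - Real.log (∫ x, Real.exp (ψ x) ∂ρ) ≤ r) :
    klDiv μ ρ ≤ ENNReal.ofReal r := by
  have hr : 0 ≤ r := by
    have := h (fun _ => 0) measurable_const 0 (fun _ => by simp)
    simpa using this
  have hbint : ∀ (ψ : X → ℝ), Measurable ψ → ∀ M : ℝ, (∀ x, |ψ x| ≤ M) →
      ∀ (ν : Measure X), IsFiniteMeasure ν → Integrable ψ ν := fun ψ hψm M hψb ν _ =>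
    Integrable.of_bound hψm.aestronglyMeasurable M
      (Eventually.of_forall fun x => by rw [Real.norm_eq_abs]; exact hψb x)
  -- Step 1: absolute continuity
  have hac : μ ≪ ρ := by
    refine Measure.AbsolutelyContinuous.mk fun A hA hρA => ?_
    by_contra hμA
    have hpos : 0 < μ.real A := ENNReal.toReal_pos hμA (measure_ne_top μ A)
    have key : ∀ t : ℝ, 0 < t → t * μ.real A ≤ r := by
      intro t ht
      set ψ : X → ℝ := A.indicator (fun _ => t) with hψ
      have hψm : Measurable ψ := measurable_const.indicator hA
      have hψb : ∀ x, |ψ x| ≤ t := fun x => by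
        by_cases hx : x ∈ A
        · simp [hψ, hx, abs_of_pos ht]
        · simp [hψ, hx, ht.le]
      have h1 : ∫ x, ψ x ∂μ = t * μ.real A := by
        rw [hψ, integral_indicator_const _ hA, smul_eq_mul, mul_comm]
      have h2 : ∫ x, Real.exp (ψ x) ∂ρ = 1 := by
        have hae : (fun x => Real.exp (ψ x)) =ᵐ[ρ] fun _ => 1 := by
          filter_upwards [measure_eq_zero_iff_ae_notMem.mp hρA] with x hx
          simp [hψ, hx]
        rw [integral_congr_ae hae]
        simp
      have := h ψ hψm t hψb
      rwa [h1, h2, Real.log_one, sub_zero] at this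
    have := key ((r + 1) / μ.real A) (by positivity)
    rw [div_mul_cancel₀ _ hpos.ne'] at this
    linarith
  -- Step 2: the density `F = dμ/dρ`
  set F : X → ℝ := fun x => (μ.rnDeriv ρ x).toReal with hF
  have hFm : Measurable F := (Measure.measurable_rnDeriv μ ρ).ennreal_toReal
  have hF0 : ∀ x, 0 ≤ F x := fun x => ENNReal.toReal_nonneg
  have hFint : Integrable F ρ := Measure.integrable_toReal_rnDeriv
  have hFone : ∫ x, F x ∂ρ = 1 := by
    rw [hF, Measure.integral_toReal_rnDeriv hac]; simp
  -- the test functions `ψ_n = clamp_n (log F)` (`= -n` where `F = 0`)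
  set ψ : ℕ → X → ℝ := fun n x =>
    if F x = 0 then -(n : ℝ) else max (-(n : ℝ)) (min (Real.log (F x)) n) with hψ
  have hψm : ∀ n, Measurable (ψ n) := fun n =>
    Measurable.ite (measurableSet_eq_fun hFm measurable_const) measurable_const
      (measurable_const.max ((Real.measurable_log.comp hFm).min measurable_const))
  have hψb : ∀ n x, |ψ n x| ≤ n := fun n x => by
    simp only [hψ]
    split_ifs with hx
    · rw [abs_neg, Nat.abs_cast]
    · rw [abs_le]
      exact ⟨le_max_left _ _, max_le (by linarith) (min_le_right _ _)⟩
  -- (i) `e^{ψ_n} ≤ F + e^{-n}`, hence `log ∫ e^{ψ_n} dρ ≤ e^{-n}`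
  have hexpψ : ∀ n x, Real.exp (ψ n x) ≤ F x + Real.exp (-(n : ℝ)) := fun n x => by
    simp only [hψ]
    split_ifs with hx
    · rw [hx, zero_add]
    · have hFpos : 0 < F x := lt_of_le_of_ne (hF0 x) (Ne.symm hx)
      rcases le_total (-(n : ℝ)) (min (Real.log (F x)) n) with hc | hc
      · rw [max_eq_right hc]
        calc Real.exp (min (Real.log (F x)) n) ≤ Real.exp (Real.log (F x)) :=
              Real.exp_le_exp.mpr (min_le_left _ _)
          _ = F x := Real.exp_log hFpos
          _ ≤ F x + Real.exp (-(n : ℝ)) := le_add_of_nonneg_right (Real.exp_pos _).le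
      · rw [max_eq_left hc]
        exact le_add_of_nonneg_left hFpos.le
  have hexpint : ∀ n, Integrable (fun x => Real.exp (ψ n x)) ρ := fun n => by
    refine Integrable.of_bound (hψm n).exp.aestronglyMeasurable (Real.exp n)
      (Eventually.of_forall fun x => ?_)
    rw [Real.norm_eq_abs, abs_of_pos (Real.exp_pos _)]
    exact Real.exp_le_exp.mpr ((le_abs_self _).trans (hψb n x))
  have hlogle : ∀ n, Real.log (∫ x, Real.exp (ψ n x) ∂ρ) ≤ Real.exp (-(n : ℝ)) := by
    intro n
    have hle : ∫ x, Real.exp (ψ n x) ∂ρ ≤ 1 + Real.exp (-(n : ℝ)) := by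
      calc ∫ x, Real.exp (ψ n x) ∂ρ ≤ ∫ x, (F x + Real.exp (-(n : ℝ))) ∂ρ :=
            integral_mono (hexpint n) (hFint.add (integrable_const _)) (hexpψ n)
        _ = 1 + Real.exp (-(n : ℝ)) := by
            rw [integral_add hFint (integrable_const _), hFone]; simp
    have hpos : 0 < ∫ x, Real.exp (ψ n x) ∂ρ := integral_exp_pos (hexpint n)
    calc Real.log (∫ x, Real.exp (ψ n x) ∂ρ) ≤ Real.log (1 + Real.exp (-(n : ℝ))) :=
          Real.log_le_log hpos hle
      _ ≤ Real.exp (-(n : ℝ)) := by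
          have := Real.log_le_sub_one_of_pos (by positivity : 0 < 1 + Real.exp (-(n : ℝ)))
          linarith
  -- (ii) `∫ ψ_n dμ ≤ r + e^{-n}` and `∫ ψ_n dμ = ∫ F ψ_n dρ`
  have hψμ : ∀ n, ∫ x, ψ n x ∂μ ≤ r + Real.exp (-(n : ℝ)) := fun n => by
    linarith [h (ψ n) (hψm n) n (hψb n), hlogle n]
  have hchange : ∀ n, ∫ x, F x * ψ n x ∂ρ = ∫ x, ψ n x ∂μ := fun n => by
    rw [← integral_rnDeriv_smul hac]
    rfl
  have hFψint : ∀ n, Integrable (fun x => F x * ψ n x) ρ := fun n =>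
    hFint.mul_bdd (hψm n).aestronglyMeasurable
      (Eventually.of_forall fun x => by rw [Real.norm_eq_abs]; exact hψb n x)
  -- (iii) `G_n = F ψ_n + 1 ≥ 0` converges pointwise to `F log F + 1`
  have hFlog : ∀ x, -1 ≤ F x * Real.log (F x) := fun x => by
    rcases eq_or_lt_of_le (hF0 x) with h0 | hpos
    · rw [← h0]; simp
    · have := Real.one_sub_inv_le_log_of_pos hpos
      have h2 : F x * (1 - (F x)⁻¹) = F x - 1 := by field_simp
      nlinarith [mul_le_mul_of_nonneg_left this hpos.le]
  have hG0 : ∀ n x, 0 ≤ F x * ψ n x + 1 := fun n x => by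
    simp only [hψ]
    split_ifs with hx
    · rw [hx]; simp
    · have hFpos : 0 < F x := lt_of_le_of_ne (hF0 x) (Ne.symm hx)
      set c := max (-(n : ℝ)) (min (Real.log (F x)) n) with hc
      rcases le_or_gt 0 c with hc0 | hc0
      · positivity
      · have hmin : min (Real.log (F x)) n < 0 := lt_of_le_of_lt (le_max_right _ _) hc0
        have hn0 : (0 : ℝ) ≤ n := Nat.cast_nonneg n
        have hL : Real.log (F x) < 0 := by
          rcases min_lt_iff.mp hmin with h' | h'
          · exact h'
          · exact absurd h' (not_lt.mpr hn0)
        have hmin_eq : min (Real.log (F x)) n = Real.log (F x) := min_eq_left (by linarith)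
        have hlog : Real.log (F x) ≤ c := by rw [hc, hmin_eq]; exact le_max_right _ _
        nlinarith [hFlog x, mul_le_mul_of_nonneg_left hlog hFpos.le]
  have hGlim : ∀ x, Tendsto (fun n : ℕ => F x * ψ n x + 1) atTop
      (𝓝 (F x * Real.log (F x) + 1)) := fun x => by
    by_cases hx : F x = 0
    · have : (fun n : ℕ => F x * ψ n x + 1) = fun _ => F x * Real.log (F x) + 1 := by
        funext n; rw [hx]; simp
      rw [this]; exact tendsto_const_nhds
    · refine tendsto_const_nhds.congr' ?_
      filter_upwards [eventually_ge_atTop ⌈|Real.log (F x)|⌉₊] with n hn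
      have hn' : |Real.log (F x)| ≤ n := (Nat.le_ceil _).trans (by exact_mod_cast hn)
      obtain ⟨h1, h2⟩ := abs_le.mp hn'
      simp only [hψ, if_neg hx, min_eq_left h2, max_eq_right h1]
  -- (iv) Fatou
  have hmeasG : ∀ n, Measurable fun x => ENNReal.ofReal (F x * ψ n x + 1) := fun n =>
    ((hFm.mul (hψm n)).add_const 1).ennreal_ofReal
  have hfatou : ∫⁻ x, ENNReal.ofReal (F x * Real.log (F x) + 1) ∂ρ ≤ ENNReal.ofReal (r + 1) := by
    have hlim : Tendsto (fun n : ℕ => ENNReal.ofReal (r + 1 + Real.exp (-(n : ℝ)))) atTop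
        (𝓝 (ENNReal.ofReal (r + 1))) := by
      refine ENNReal.tendsto_ofReal ?_
      have : Tendsto (fun n : ℕ => Real.exp (-(n : ℝ))) atTop (𝓝 0) :=
        Real.tendsto_exp_neg_atTop_nhds_zero.comp tendsto_natCast_atTop_atTop
      simpa using tendsto_const_nhds.add this
    calc ∫⁻ x, ENNReal.ofReal (F x * Real.log (F x) + 1) ∂ρ
        = ∫⁻ x, liminf (fun n : ℕ => ENNReal.ofReal (F x * ψ n x + 1)) atTop ∂ρ :=
          lintegral_congr fun x =>
            ((ENNReal.continuous_ofReal.tendsto _).comp (hGlim x)).liminf_eq.symm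
      _ ≤ liminf (fun n : ℕ => ∫⁻ x, ENNReal.ofReal (F x * ψ n x + 1) ∂ρ) atTop :=
          lintegral_liminf_le hmeasG
      _ ≤ liminf (fun n : ℕ => ENNReal.ofReal (r + 1 + Real.exp (-(n : ℝ)))) atTop := by
          refine liminf_le_liminf (Eventually.of_forall fun n => ?_)
          rw [← ofReal_integral_eq_lintegral_ofReal (f := fun x => F x * ψ n x + 1)
            ((hFψint n).add (integrable_const _)) (Eventually.of_forall (hG0 n))]
          refine ENNReal.ofReal_le_ofReal ?_
          rw [integral_add (hFψint n) (integrable_const _), hchange n]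
          simp only [integral_const, probReal_univ, smul_eq_mul, one_mul]
          linarith [hψμ n]
      _ = ENNReal.ofReal (r + 1) := hlim.liminf_eq
  -- (v) integrability of `F log F` and the bound
  have hGm : Measurable fun x => F x * Real.log (F x) + 1 :=
    (hFm.mul (Real.measurable_log.comp hFm)).add_const 1
  have hGint : Integrable (fun x => F x * Real.log (F x) + 1) ρ := by
    refine ⟨hGm.aestronglyMeasurable, ?_⟩
    rw [HasFiniteIntegral, lintegral_congr fun x => Real.enorm_eq_ofReal (by linarith [hFlog x])]
    exact lt_of_le_of_lt hfatou ENNReal.ofReal_lt_top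
  have hFlogint : Integrable (fun x => F x * Real.log (F x)) ρ :=
    (hGint.sub (integrable_const (1 : ℝ))).congr (Eventually.of_forall fun x => by simp)
  have hFlogle : ∫ x, F x * Real.log (F x) ∂ρ ≤ r := by
    have h1 : ∫ x, (F x * Real.log (F x) + 1) ∂ρ ≤ r + 1 := by
      rw [integral_eq_lintegral_of_nonneg_ae (Eventually.of_forall fun x => by
        simp only [Pi.zero_apply]; linarith [hFlog x]) hGm.aestronglyMeasurable]
      calc (∫⁻ x, ENNReal.ofReal (F x * Real.log (F x) + 1) ∂ρ).toReal
          ≤ (ENNReal.ofReal (r + 1)).toReal := ENNReal.toReal_mono ENNReal.ofReal_ne_top hfatou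
        _ = r + 1 := ENNReal.toReal_ofReal (by linarith)
    rw [integral_add hFlogint (integrable_const _)] at h1
    simp only [integral_const, probReal_univ, smul_eq_mul, one_mul] at h1
    linarith
  -- conclusion
  have hllr : (fun x => (μ.rnDeriv ρ x).toReal • llr μ ρ x) = fun x => F x * Real.log (F x) := by
    funext x; simp [llr, hF, smul_eq_mul]
  have h_int : Integrable (llr μ ρ) μ := (integrable_rnDeriv_smul_iff hac).mp (hllr ▸ hFlogint)
  have hkl : klDiv μ ρ = ENNReal.ofReal (∫ x, llr μ ρ x ∂μ) := by
    rw [klDiv_of_ac_of_integrable hac h_int]; simp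
  rw [hkl, ← integral_rnDeriv_smul hac, hllr]
  exact ENNReal.ofReal_le_ofReal hFlogle

/-- **Donsker–Varadhan, hard half** (pseudo-metrizable Borel space): if
`∫ φ dμ - log ∫ e^φ dρ ≤ r` for every bounded continuous `φ`, then `H(μ | ρ) ≤ r`. [folklore] -/
theorem klDiv_le_of_forall_boundedContinuous [TopologicalSpace X]
    [TopologicalSpace.PseudoMetrizableSpace X] [BorelSpace X] {μ ρ : Measure X}
    [IsProbabilityMeasure μ] [IsProbabilityMeasure ρ] {r : ℝ}
    (h : ∀ φ : X →ᵇ ℝ, ∫ x, φ x ∂μ - Real.log (∫ x, Real.exp (φ x) ∂ρ) ≤ r) :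
    klDiv μ ρ ≤ ENNReal.ofReal r :=
  klDiv_le_of_forall_bounded_measurable fun _ hψm _ hψb =>
    integral_sub_log_integral_exp_le_of_forall_boundedContinuous h hψm hψb

/-! ### Entropy bounds pass to weak limits -/

/-- **Lower semicontinuity of the relative entropy along weak limits** (sublevel form): if the
probability measures `μs i` converge weakly to `μ` along a non-trivial filter and every `μs i`
satisfies the Donsker–Varadhan inequalities `∫ φ d(μs i) - log ∫ e^φ dρ ≤ r` for bounded
continuous `φ` (e.g. `H(μs i | ρ) ≤ r`), then `H(μ | ρ) ≤ r`. [folklore] -/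
theorem klDiv_le_of_tendsto [TopologicalSpace X] [TopologicalSpace.PseudoMetrizableSpace X]
    [BorelSpace X] {ι : Type*} {F : Filter ι} [NeBot F] {μs : ι → ProbabilityMeasure X}
    {μ : ProbabilityMeasure X} (hlim : Tendsto μs F (𝓝 μ)) (ρ : Measure X)
    [IsProbabilityMeasure ρ] {r : ℝ}
    (h : ∀ i, ∀ φ : X →ᵇ ℝ,
      ∫ x, φ x ∂(μs i : Measure X) - Real.log (∫ x, Real.exp (φ x) ∂ρ) ≤ r) :
    klDiv (μ : Measure X) ρ ≤ ENNReal.ofReal r := by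
  refine klDiv_le_of_forall_boundedContinuous fun φ => ?_
  have hconv : Tendsto (fun i => ∫ x, φ x ∂(μs i : Measure X)) F (𝓝 (∫ x, φ x ∂(μ : Measure X))) :=
    (ProbabilityMeasure.tendsto_iff_forall_integral_tendsto.mp hlim) φ
  have hle : ∫ x, φ x ∂(μ : Measure X) ≤ r + Real.log (∫ x, Real.exp (φ x) ∂ρ) :=
    le_of_tendsto' hconv fun i => by linarith [h i φ]
  linarith

/-- The weak-limit entropy bound from entropy bounds of the approximants:
`H(μs i | ρ) ≤ C` for all `i` (`C < ∞`) gives `H(μ | ρ) ≤ C`. [folklore] -/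
theorem klDiv_le_of_tendsto_of_klDiv_le [TopologicalSpace X]
    [TopologicalSpace.PseudoMetrizableSpace X] [BorelSpace X] {ι : Type*} {F : Filter ι}
    [NeBot F] {μs : ι → ProbabilityMeasure X} {μ : ProbabilityMeasure X}
    (hlim : Tendsto μs F (𝓝 μ)) (ρ : Measure X) [IsProbabilityMeasure ρ] {C : ℝ≥0∞}
    (hC : C ≠ ⊤) (h : ∀ i, klDiv (μs i : Measure X) ρ ≤ C) :
    klDiv (μ : Measure X) ρ ≤ C := by
  have := klDiv_le_of_tendsto hlim ρ (r := C.toReal) fun i φ =>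
    integral_boundedContinuous_sub_log_le hC (h i) φ
  rwa [ENNReal.ofReal_toReal hC] at this

end Summit.AtomisticToContinuum.FouriersLaw.Theorems.CesaroUpgrade

end
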